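import Mathlib
import HarnessLib
import HarnessLib.Audit
import Summits.AtomisticToContinuum.Statement
import Literature.MathematicalPhysics.KineticTheory.StationaryLanfordState
import Summits.AtomisticToContinuum.HydrodynamicLimit.Theorems.TwoClocksEntropyToHydro
import HarnessLib.Audit.Status.Attr

/-!
Route: BGEndpointRigidity

DORMANT since 2026-08-24T10:58:24Z (reconciler: no traction for 6.7 d (last activity item-evidence-added at 2026-08-17T17:03:48Z); parked, not closed — `ledger route dormant route-AtomisticToContinuum-BGEndpointRigidity --off` to reacti) — unstaffed, not closed; items shared with open routes are served there. `ledger route dormant <id> --off` reactivates.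

# Route BGEndpointRigidity — Boltzmann's hypothesis is a theorem at the Boltzmann–Grad endpoint;
stationary states persist from it

It suffices to show X = X_BH ∧ K3, realising card bg-endpoint-rigidity (spine). X_BH (LANFORD-CLASS
BOLTZMANN HYPOTHESIS; typed crux LanfordBoltzmannHypothesisR2 since rev 12, over the landed
StationaryLanfordState / InfiniteHardSphereFlow / IsHardSphereGibbsMixture): there is φ₀ > 0 such
that every translation-invariant,
stationary, Lanford-regular (rescaled correlation measures ≤ Cᵏ e^(−βE_k) dZ_k, any C, any β > 0),
VACUUM-FREE and COMPONENTWISE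
DILUTE (a.s. asymptotic empirical reduced density ≤ φ₀) state of an equilibrium infinite hard-sphere
flow in ℝ³ is a mixture of the
Gibbs states g_(z,u,β). X_BH is proved NOT as an ergodic theorem but as PERSISTENCE OF A RIGID
ENDPOINT: (E) at the Boltzmann–Grad point
the classification is a theorem — Boltzmann–Grad limits of stationary Lanford-bounded states are
admissible stationary solutions of the
Boltzmann hierarchy, hence (de Finetti) statistical solutions invariant in law, hence (H-theorem)
Maxwell–Poisson mixtures (typed crux HierarchyEndpointRigidityR — the continuous Lanford class — +
support EndpointHTheorem); (E1) ETERNAL LANFORD — for a stationary state one Lanford window is an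
exact
identity for all time (informal crux StationaryLanfordConsistency); (P) ISOLATION of the Gibbs
family for φ < φ₀ by three non-degeneracy
constants — Grad's gap, the Dorfman–Cohen ring-return amplitude O(φ log 1/φ), and the two-particle
Liouville theorem in the hydrodynamic
sector (informal crux Isolation; its two-particle Liouville lemma is layer 2, see TWO-LAYER PLAN).
K3 (typed crux LanfordEnvelopeR, marginals read on the hard-sphere domain): the evolved local-Gibbs
law at fixed
σ < σ₀ keeps an N-uniform Gaussian (Lanford) envelope on its marginals, so its mean-free-path-scale
local limits lie in the class X_BH
classifies. X_BH ∧ K3 supply step (B) of OllaVaradhanYau1993 §4 for the DETERMINISTIC dynamics — the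
only step where they use noise —
and their (A), (C)–(E) + Yau's Gronwall, run INSIDE THE PACKING BAND ρ_t(x)σ³ < η₀ that the re-typed
conjunct itself now grants
(Statement re-type p126922, 2026-08-16: `∃ η₀ > 0` outermost, the guard `∀ t ∈ [0,T) ∀ x, ρ_t(x)σ³ <
η₀` a HYPOTHESIS on the classical
Euler solution; η₀ is chosen below X_BH's φ₀ and the dilute-statics radius), give the GUARDED Yau
target RelEntropyVanishingInBand
(typed target since rev 15: the relative-entropy form of the conjunct with the same guard — the
shared unguarded target 0766 and the PDE
crux DiluteSelfConsistency 3091 that used to manufacture the band are no longer on this line) — this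
is the typed glue GronwallBGInBand —
whence the conjunct, with the SAME η₀ and σ₀, by the landed entropy-inequality step
Theorems.tendstoHydroFieldsAt_of_klDiv at each t < T,
invoked inside `closes`.
Lean: `∃ η₀ : ℝ, 0 < η₀ ∧ ∀ (a₀ θ₀ : Literature.MathematicalPhysics.KineticTheory.T3 → ℝ) (u₀ :
Literature.MathematicalPhysics.KineticTheory.T3 → Literature.MathematicalPhysics.KineticTheory.V3),
Continuous a₀ → Continuous θ₀ → Continuous u₀ → (∀ x, 0 < a₀ x) → (∀ x, 0 < θ₀ x) → ∃ σ₀ : ℝ, 0 < σ₀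
∧ ∀ σ : ℝ, 0 < σ → σ < σ₀ → ∀ (T : ℝ) (ρ θ : ℝ → Literature.MathematicalPhysics.KineticTheory.T3 →
ℝ) (u : ℝ → Literature.MathematicalPhysics.KineticTheory.T3 →
Literature.MathematicalPhysics.KineticTheory.V3),
Literature.MathematicalPhysics.KineticTheory.IsHardSphereEulerSolution σ T ρ u θ → (∀ t ∈ Set.Ico 0
T, ∀ x, ρ t x * σ ^ 3 < η₀) → ∀ Φ : (N : ℕ) → Literature.Analysis.FluidPDE.HardSphereFlow
(Literature.Analysis.FluidPDE.Torus.geometry (Fin 3))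
(Literature.MathematicalPhysics.KineticTheory.hsDiameter σ N) (N + 1), (∀ N,
MeasureTheory.IsProbabilityMeasure (Literature.MathematicalPhysics.KineticTheory.localGibbsLaw σ a₀
u₀ θ₀ N (Φ N))) ∧ (Literature.MathematicalPhysics.KineticTheory.TendstoHydroFieldsAt (fun N =>
Literature.MathematicalPhysics.KineticTheory.localGibbsLaw σ a₀ u₀ θ₀ N (Φ N)) Φ ρ u θ 0 → ∀ t ∈
Set.Ico 0 T, ∃ a : Literature.MathematicalPhysics.KineticTheory.T3 → ℝ, (∀ N,
MeasureTheory.IsProbabilityMeasure (Literature.MathematicalPhysics.KineticTheory.localGibbsLaw σ a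
(u t) (θ t) N (Φ N))) ∧ (∀ χ : Literature.MathematicalPhysics.KineticTheory.T3 → ℝ, Continuous χ → ∀
δ : ℝ, 0 < δ → ∃ C : ℝ, 0 < C ∧ ∀ N : ℕ, Literature.MathematicalPhysics.KineticTheory.localGibbsLaw
σ a (u t) (θ t) N (Φ N) {z | δ < |Literature.MathematicalPhysics.KineticTheory.empiricalDensityField
z χ - ∫ x, χ x * ρ t x|} ≤ ENNReal.ofReal (C * Real.exp (-(C⁻¹ * (N + 1)))) ∧
Literature.MathematicalPhysics.KineticTheory.localGibbsLaw σ a (u t) (θ t) N (Φ N) {z | δ <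
‖Literature.MathematicalPhysics.KineticTheory.empiricalMomentumField z χ - ∫ x, (χ x * ρ t x) • u t
x‖} ≤ ENNReal.ofReal (C * Real.exp (-(C⁻¹ * (N + 1)))) ∧
Literature.MathematicalPhysics.KineticTheory.localGibbsLaw σ a (u t) (θ t) N (Φ N) {z | δ <
|Literature.MathematicalPhysics.KineticTheory.empiricalEnergyField z χ - ∫ x, χ x *
Literature.MathematicalPhysics.KineticTheory.totalEnergyDensity (ρ t x) (u t x) (θ t x)|} ≤
ENNReal.ofReal (C * Real.exp (-(C⁻¹ * (N + 1))))) ∧ Filter.Tendsto (fun N : ℕ =>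
InformationTheory.klDiv ((Φ N).lawAt (Literature.MathematicalPhysics.KineticTheory.localGibbsLaw σ
a₀ u₀ θ₀ N (Φ N)) t) (Literature.MathematicalPhysics.KineticTheory.localGibbsLaw σ a (u t) (θ t) N
(Φ N)) / ((N : ENNReal) + 1)) Filter.atTop (nhds 0))`

## Assembly
Outer frame: the deciding theorem is CRUX-ONLY (rev 16, gate rule glue.non-crux-hypothesis), `closes
(_h₀ : RelEntropyVanishingInBand)
(hEnv : LanfordEnvelopeR) (_hE : HierarchyEndpointRigidityR) (hBH : LanfordBoltzmannHypothesisR2)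
(hG : GronwallBGInBand) :
_root_.HydrodynamicLimit` — the typed target and cruxes are its hypotheses (GronwallBGInBand badged
crux for that reason; the supports
EndpointHTheorem and Assembly are not binders); the guarded target is not USED but PRODUCED, `obtain
⟨η₀, hη₀, H⟩ := hG hBH hEnv`, and the packing-guarded
conjunct follows with the same η₀ and the same σ₀: for σ < σ₀, a guarded classical solution, flows Φ
and the t = 0 LLN, the target hands
over the reference activity a_t with exponential concentration and klDiv/(N+1) → 0, and
`Theorems.tendstoHydroFieldsAt_of_klDiv (a := a_t)
Φ hconc hkl` (Theorems/TwoClocksEntropyToHydro.lean, landed p85039; the entropy inequality for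
events + `Measure.le_map_apply` along the
flow) returns the LLN at t — eight lines, the in-band dock pattern of
Theorems/ImplosionDichotomyHydroLimitInBandEntropyDock.lean; the
route file imports that Theorems module for it (as PesinPricing / AntiMazurCoboundaries /
MirrorJeffreys / MourreKoopmanCharges do; its
only Summits-side import is Theses.TwoClocks — no cycle). REV 15 (route-repair statement-revised,
2026-08-16, p126922 re-typed
`_root_.HydrodynamicLimit` from the unguarded Literature abbrev to the packing-guarded def, verbatim
HydroLimitInBandDim 3): the new
hypothesis of the conjunct is CONSUMED, not discarded through `HydrodynamicLimit.of_unguarded` — it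
replaces crux #7 DiluteSelfConsistency
(stmt-3091, dropped from this route, still wanted by its other routes; its negation DenseExcursion
no longer bears on the conjunct nor on
this line) as the source of dilute visitation in the Gronwall glue, with η₀ existential and
outermost exactly as the glue needs it (an
absolute threshold fixed from φ₀ before the profiles); GronwallBGR (stmt-14531: R2 → 3091 → K3 →
0766) is superseded by GronwallBGInBand
(R2 → K3 → RelEntropyVanishingInBand); the unguarded target RelEntropyVanishing (0766) and the
transfer EntropyMethodTransfer (9240 —
closed·proved for the OLD abbrev: its recorded proof
`Theorems.hydrodynamicLimit_of_relEntropyVanishing` concludes the Literature constant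
and no longer has the item's type, so its `_holds` link cannot be rendered in this file) are dropped
from this route; Assembly (13927) is
restated to the guarded chain LanfordEnvelopeR → HierarchyEndpointRigidityR →
LanfordBoltzmannHypothesisR2 → RelEntropyVanishingInBand →
_root_.HydrodynamicLimit. Revs 12–14 (route-repair 2026-08-16, gate stamp route.target-unreachable;
two concurrent seats consolidated at
rev 14): X_BH typed as LanfordBoltzmannHypothesisR2 (stmt-14475), the informal 11484/11485 and the
rev-12 ergodic restates 14377/14378
retired, the target made PRODUCED by a typed Gronwall glue. X_BH is typed in the vacuum-free,
componentwise-dilute MIXTURE form: the literal mean-density typing of the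
informal stmt-11484 was refuted as prose by vacuum dilution ½δ_∅ + ½g and by thin-Gibbs dilution
(refuter-rattack-11484, Dilution.lean),
and the spatially-ergodic form C″ recommended there is not consumable by the Gronwall glue, which
meets NON-ergodic local limits and
cannot make spatially-ergodic components stationary without first excluding macrostate cycling —
itself part of Boltzmann's hypothesis;
the mixture form with ν{∅} = 0 and an a.s. bound on the asymptotic empirical density answers both
dilution witnesses (pattern of the
typed sibling crux AnosovDiceHopf.OVYLimitsAreGibbs). Earlier repairs kept: rev 4 — LanfordEnvelope
(stmt-11470, refuted-misstated by
Summit.AtomisticToContinuum.HydrodynamicLimit.Theorems.BGEndpointRigidityLanfordEnvelope_refuted,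
volume-marginals of flow junk off `good`)
and HierarchyEndpointRigidity (stmt-11471, null-set switch-off of the ε = 0 collision term) replaced
1:1 by LanfordEnvelopeR /
HierarchyEndpointRigidityR, refuted record kept as a negative edge; revs 1–2 — support
TwoParticleLiouville and the LinearizedBoltzmann
import dropped (cone repair); rev 11 — Assembly restated off the ground.trivial tautology. The route
file imports, beyond
the Statement, Literature.MathematicalPhysics.KineticTheory.StationaryLanfordState (the definition
request D1 of this route) and
Summits.AtomisticToContinuum.HydrodynamicLimit.Theorems.TwoClocksEntropyToHydro (the landed entropy
step used inside `closes`).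
Inner (informal, the persistence line proper): Isolation (extremal ν) ∧ StationaryLanfordConsistency
∧ (the ℝ³ / Maxwell–Poisson form of)
HierarchyEndpointRigidityR ⇒ LanfordBoltzmannHypothesisR2 — to become the glued split of that crux
once 11482/11483 are typed.

Rationale: WHY THIS LINE. OllaVaradhanYau1993 (§1 p. 525, §4 (A)–(E)) add noise for one purpose — to know that,
given the positions, the momenta of a
translation-invariant stationary state are mixtures of Maxwellian products — and Spohn1991 (§2.4 p.
25: "one expects that the time invariant
measures agree with the Gibbs measures"; ad 2.4: Gurevich–Suhov settle it only for smooth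
potentials, at hierarchy level) records why no
ergodic theorem supplies this; the card's observation is that this classification is TRUE AND
PROVABLE at the
Boltzmann–Grad endpoint of the family of stationary problems indexed by the conjunct's own σ:
Lanford's theorem, valid "only to a fraction of
the average time between two collisions" (CIP1994 Thm 4.4.1, p. 86), becomes an exact eternal
constraint on a STATIONARY state, Boltzmann–Grad
limits of symmetric laws are de Finetti/Cox mixtures (DiaconisFreedman1987, Kallenberg2002 Ch. 11;
the ideal-gas template
doi:10.1090/trans2/198/06 with doi:10.1007/bf00535277), hierarchy solutions are statistical
solutions (doi:10.1007/bfb0071883 §4, eq. (4.3),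
read) and Boltzmann's own H-theorem classifies the invariant ones (CIP1994 §3.2–3.3, Arkeryd1972,
DesvillettesVillani2005) — Spohn's
heuristic remark (doi:10.1007/bfb0071883 §5 (iii)) made a theorem in the Lanford class. Imported
areas, with an explicit dictionary: dynamical
systems (persistence of a normally non-degenerate manifold of equilibria: F_ε ↦ BBGKY generator in
Boltzmann–Grad units, F₀ ↦ Boltzmann
hierarchy, equilibria ↦ Maxwell–Poisson/Gibbs mixtures, normal hyperbolicity ↦ Grad gap
BarangerMouhot2005 + Ellis–Pinsky dissipativity +
ring-return bound DorfmanCohen1972/Cohen1967); point processes (de Finetti/Cox limits); kinetic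
spectral theory (the tree's proved facts
`hardSphereLinearizedOp_eq_zero_iff_holds`,
`le_neg_maxwellianInner_hardSphereLinearizedOp_of_orthogonal_holds`); the relative-entropy
method (Yau1991, OllaVaradhanYau1993) as the unchanged outer frame. Versus routes on file:
UGibbsSRBRigidity classifies inside the u-Gibbs
class by an infinite-volume Hopf argument with no small parameter; AnosovDiceHopf poses the same
one-block input (OVYLimitsAreGibbs) and
attacks it by dice/Hopf chains; FluxGibbsianityLdDrude dualises into flux-Gibbsianity;
MourreKoopmanCharges is single-state L²(Gibbs)
commutator theory, blind to states singular w.r.t. Gibbs; the retired RelEntropyErgodic asked the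
classification for ALL finite-entropy
states with no mechanism. None poses the Boltzmann hypothesis perturbatively from an
endpoint where it is true; nothing in the negatives index (12 statements) is touched.

RANKED CRUXES. #0 RelEntropyVanishingInBand (target, rev 15) — Yau's relative-entropy form of the
PACKING-GUARDED limit: ∃ η₀ > 0 (outermost)
∀ continuous profiles ∃ σ₀ ∀ σ < σ₀ ∀ classical hs-Euler solutions on [0,T) WITH ρ_t(x)σ³ < η₀ on
[0,T) × 𝕋³ ∀ flows, the local Gibbs
laws are probability measures and, given the LLN at t = 0, for every t < T there is an activity
profile a_t whose local Gibbs law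
(a_t, u_t, θ_t) concentrates exponentially around (ρ, ρu, E)(t) and H(f^N_t |
localGibbs(a_t,u_t,θ_t))/(N+1) → 0 — i.e. the shared
unguarded target stmt-0766 with the conjunct's own guard inserted after the Euler solution (verbatim
the hypothesis of the landed in-band
dock Theorems.hydroLimitInBand_of_relEntropyVanishingInBand and the C⁺ `RelEntropyVanishingInBand`
of the HydroLimitInBand crux line
IdeatorOneSketch). Reached here by the TYPED glue GronwallBGInBand : LanfordBoltzmannHypothesisR2 →
LanfordEnvelopeR → this (rev 15); it
yields the conjunct with the same η₀ and σ₀ inside `closes`. (why it might fail: OVY93 Thm 2.1 holds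
only WITH noise; deterministically an
extensive non-Gibbs invariant structure of local limits would carry wrong currents even in band; and
H_N(t) = o(N) can fail before T
through N-uniformly uncontrolled large velocities although ρσ³ stays below η₀.)
[OllaVaradhanYau1993, Yau1991, Spohn1991, LiveraniOlla1996]
#1 Assembly (assembly, restated rev 15) — LanfordEnvelopeR → HierarchyEndpointRigidityR →
LanfordBoltzmannHypothesisR2 →
RelEntropyVanishingInBand → _root_.HydrodynamicLimit, the typed cruxes and the guarded target imply
the Statement BY NAME; provable now
from the target alone by the eight lines of `closes` (entropy inequality,
Theorems.tendstoHydroFieldsAt_of_klDiv). [KipnisLandim1999,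
OllaVaradhanYau1993]
#2 Isolation, #3 StationaryLanfordConsistency (cruxes, INFORMAL; persistence step (P) and eternal
Lanford (E1) of the card): texts,
why-might-fail and sources as filed at open / rev 1; refuter verdicts to adopt at typing — Isolation
posed for EXTREMAL (spatially ergodic) ν
(rattack-11482: near-diagonal Gibbs mixtures have small non-zero deviation and ARE mixtures) and
split P1/P2/P3; StationaryLanfordConsistency
survives two attacks (rattack-11483, -g2; sharpenings M1–M4; clause (a) needs an infinite-volume
BBGKY–Duhamel operator). [DorfmanCohen1972, Cohen1967,
BarangerMouhot2005, CIP1994, GST2013, BGSSCPAM2023, doi:10.1214/23-aop1656]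
#4 LanfordEnvelopeR (crux) — LANFORD ENVELOPE AT FIXED REDUCED DENSITY, READ ON THE HARD-SPHERE
DOMAIN (card K3, finite-N form; rev-4
repair of stmt-11470: indicator of hardSphereDomain inside the volume-marginal): for continuous
local-Gibbs profiles (a₀ > 0, u₀, θ₀ > 0) ∃ σ₀ > 0 ∀ 0 < σ < σ₀ ∀ T > 0
∃ β > 0, C ∀ N ∀ hard-sphere flows Φ of N+1 spheres of diameter σ(N+1)^(−1/3) on 𝕋³ ∀ s ∀ t ∈ [0,T]:
for a.e. Z_s the s-particle
volume-marginal of 1_{D_ε}·(W_N ∘ Φ_(−t)) is ≤ C^s e^(−βE(Z_s)) in absolute value — Lanford's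
Gaussian sup bounds, N-uniform along the
NON-equilibrium evolution at fixed density, making mean-free-path-scale local limits Lanford-regular
AND controlling large velocities
(exponential velocity moments) for GronwallBGInBand. By hand it holds for s = 0, t = 0, s = N+1 and
s ≥ (N+1)/2 (energy conservation + insertion
bound); the content is bounded s at t > 0. [difficulty: XL] (why it might fail: Content =
HighMomentumCutoff barrier in marginal form: the only N-uniform a-priori bound 𝒵⁻¹A^(N+1)e^(−β′E) is
off by e^(cN) at small s; collisional
energy concentration on few particles breaks any fixed Gaussian envelope.) [GST2013, BGSSAnnals2023,
BGSSCPAM2023, OllaVaradhanYau1993,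
Spohn1991, doi:10.1007/bf01218628]
#5 HierarchyEndpointRigidityR (crux) — BOLTZMANN'S HYPOTHESIS IS A THEOREM AT THE BOLTZMANN–GRAD
POINT, CONTINUOUS LANFORD CLASS (card (E) =
(E2)+(E3), typed at ε = 0 on 𝕋³; rev-4 1:1 replacement of stmt-11471 with `∀ s, Continuous (F s)`):
a time-independent family F = (F_s)_s
of measurable, CONTINUOUS, non-negative functions on (𝕋³ × ℝ³)^s with F_s ≤ C^s e^(−βE(Z_s)) that is
(i) a STATIONARY mild solution of the
Boltzmann hierarchy on some [0,T], T > 0, and (ii) ADMISSIBLE (mode-A limit at time 0 —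
TendstoMarginals — of marginals of symmetric
probability densities W_k of N_k → ∞ particles with uniform Gaussian bounds) is a mixture of
Maxwellian products: ∃ probability π on (u,
θ) ∈ ℝ³ × ℝ, π{θ ≤ 0} = 0, F_s = ∫ (M_(1,u,θ))^(⊗s) dπ a.e. ∀ s. Line: de Finetti → hierarchy
uniqueness in the Lanford class + Ukai–Lanford
flow ⇒ law(Λ) invariant ⇒ EndpointHTheorem ⇒ Λ Maxwellian a.s. [deps: EndpointHTheorem] [difficulty:
L] (why it might fail: admissibility essential (linear hierarchy has non-mixture stationary
solutions, Spohn 1984 §5); needs the H-equality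
case for continuous Gaussian-bounded mild solutions with zero sets on 𝕋³ — not in print.)
[doi:10.1007/bfb0071883,
book:cercignani1984-kinetic-theories-boltzmann-equation pp.148-152, CIP1994, Arkeryd1972,
DiaconisFreedman1987, DesvillettesVillani2005,
GenoveseSimonella2012]
#6 LanfordBoltzmannHypothesisR2 (crux, TYPED rev 13, stmt-14475; with the informal stmt-11484 —
refuted-misstated AS PROSE by
rattack-11484 — and its rev-12 ergodic 1:1 restate stmt-14377 both retired) — the route's X_BH = the
persisted endpoint, in the
vacuum-free componentwise-dilute MIXTURE form: ∃ φ₀ > 0 ∀ ε > 0 ∀ equilibrium flows Φ :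
InfiniteHardSphereFlow (Fin 3) ε ∀ φ C ∀ β > 0 ∀ ν, StationaryLanfordState Φ φ C β ν → ν{∅} = 0 →
(ν-a.s. eventually in n: ε³·#(ω ∩
centredBox n × ℝ³) ≤ φ₀·vol(centredBox n)) → IsHardSphereGibbsMixture ε ν. It is the
conjunct-independent half of the thesis (X = X_BH ∧
K3) and the parent of the line #2–#3–#5(ℝ³ form); a direct attack is Boltzmann's hypothesis head-on,
hence the low staffing rank.
[difficulty: open-problem] (why it might fail: open for every deterministic interacting gas
(Spohn1991 p. 25); φ₀ uniform in the Lanford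
constant C admits locally clustered states outside any φ-expansion; the flow hypothesis pins an
equilibrium flow only Gibbs-a.e., i.e. not at
all on a non-Gibbs candidate.) [Spohn1991, OllaVaradhanYau1993, NachtergaeleYau2003,
GurevichSuhov1976, Alexander1976]
(#7 DiluteSelfConsistency, shared stmt-AtomisticToContinuum-3091, ∀ η > 0 … ρ_t(x)σ³ < η — DROPPED
from this route at rev 15: the
conjunct's packing guard, a hypothesis on the classical solution since the Statement re-type
p126922, is exactly the dilute visitation
3091 was filed here to guarantee (it was needed only at η = the φ₀-threshold); 3091 stays wanted by
its other routes, and its negation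
DenseExcursion (ImplosionDichotomy; MerleEtAl2022 / BuckmasterCaolaboraGomezserrano2025 implosions
shadowed to packing O(1)) no longer
touches this line — an imploding profile leaves the conjunct's scope before it leaves the band.)
#7 GronwallBGInBand (crux since rev 16 — it is an open hypothesis of the crux-only `closes`, gate
rule glue.non-crux-hypothesis — lowest
staffing priority: technique known; TYPED glue, stmt-17626, rev 15; supersedes GronwallBGR
stmt-14531 = R2 → 3091 → K3 → 0766 and, before
it, the informal stmt-11485 / GronwallBG stmt-14378) — LanfordBoltzmannHypothesisR2 →
LanfordEnvelopeR → RelEntropyVanishingInBand: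
OllaVaradhanYau1993 §4 for the deterministic torus gas IN BAND — take η₀ := min(φ₀/2, η_stat) from
X_BH's φ₀ and the dilute-statics
radius η_stat (EOS inversion a ↦ ρ and cluster expansion of the hard-sphere local Gibbs states), an
absolute constant fixed before the
profiles as the outermost ∃ requires, and σ₀ := min of the inputs' σ₀; for σ < σ₀ and a classical
solution obeying the GUARD ρ_t(x)σ³ <
η₀ on [0,T): (A) limit points of the space–time averaged blown-up laws (FluidPDE.localLawTimeAvg /
KineticTheory.IsOVYLimitState; diameter
1 after blow-up) are translation invariant; (A′) by the envelope they are Lanford-regular,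
vacuum-free (ρ_t > 0) and, with finite
collision clusters, a.e. defined and STATIONARY for Alexander's equilibrium flow; the entropy
bootstrap (entropy inequality against
mesoscopic large deviations of the dilute local Gibbs reference, admissible because ρ_sσ³ < η₀ by
the guard — formerly by #7) makes them
componentwise dilute, density < φ₀, with an error linear in H_N(s)/N; (B) #6 classifies them as
Gibbs mixtures; (C)–(E) verbatim (block
averages, large deviations for the dilute Gibbs reference by cluster expansion, equation of state
via the contact value, large
velocities by the same envelope); Yau's dH_N/dt ≤ C H_N + o(N) against ψ_t = localGibbsLaw σ
a(ρ_t,σ) u_t θ_t, Gronwall and H_N(0) =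
o(N) give the target with a_t = a(ρ_t, σ). [difficulty: XL; technique known] (why it might fail:
even given (B) and the envelope, the
deterministic one/two-block and large-deviation steps need Alexander's flow on ALL Lanford-regular
dilute data and dilute hs-Gibbs large
deviations uniform along the evolution, and the entropy bootstrap's error, linear in H_N(s)/N, must
close by Gronwall before T — none of
it is in print without noise.) [OllaVaradhanYau1993, Yau1991, KipnisLandim1999, Spohn1991,
Alexander1976]
#9 EndpointHTheorem (support) — ENDPOINT H-THEOREM on 𝕋³ (the engine of (E3)): an a.e.-mild,
measurable, Gaussian-bounded solution of the
hard-sphere Boltzmann equation on 𝕋³ × [0,T] with H(f(T)) ≥ H(f(0)) starts at a GLOBAL Maxwellian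
a.e. [difficulty: M; grounded
known-in-substance, core facts proved in tree] [CIP1994, Arkeryd1972, DesvillettesVillani2005]
(EntropyMethodTransfer, shared stmt-9240, RelEntropyVanishing → `_root_.HydrodynamicLimit` — DROPPED
from this route at rev 15 together
with the unguarded target 0766: the entropy-inequality transfer is now performed inside `closes` by
the landed
Theorems.tendstoHydroFieldsAt_of_klDiv; 9240's recorded proof
Theorems.hydrodynamicLimit_of_relEntropyVanishing concludes the OLD
unguarded abbrev and no longer has the item's type after the re-type.)

TWO-LAYER PLAN. Foreseen glued splits (nothing filed now; k ≤ 3, depth 1):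
LanfordBoltzmannHypothesisR2 ⇐ ErgodicBoltzmannHypothesis (=
the retired stmt-14377 VERBATIM, the refuter's C″: ∃ φ₀ ∀ 0 < φ < φ₀ ∀ equilibrium Φ :
InfiniteHardSphereFlow (Fin 3) φ ∀ C ∀ β > 0 ∀ ν,
StationaryLanfordState Φ φ C β ν → IsSpatiallyErgodic ν → ν ∈ hardSphereGibbsStates (Fin 3) φ — the
conclusion the Isolation line #2–#3–#5
actually reaches, extremal ν) → NoCyclingDecomposition (spatially-ergodic components of a
vacuum-free componentwise-dilute stationary Lanford
state are stationary Lanford states with constant C/p and density < φ₀: the no-macrostate-cycling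
step) → LanfordBoltzmannHypothesisR2;
ErgodicBoltzmannHypothesis itself ⇐ IsolationErg (extremal-ν form of #2) ∧ EternalLanford (typed #3,
sharpenings M1–M4) ∧ EndpointRigidityR3
(ℝ³ / Maxwell–Poisson form of #5) is the persistence line proper and becomes a separate ROUTE
sharing the decl if the two-layer bound bites;
11482/11483 are superseded by those children. HierarchyEndpointRigidityR ⇐ DeFinettiLanford
(admissible Lanford-bounded
hierarchy data are moment families E[Λ^(⊗s)] of a random L∞ density Λ ≤ C M_β) →
StatSolutionInvariance (law(Λ) invariant under the L∞
Ukai–Lanford flow) → HierarchyEndpointRigidityR. LanfordEnvelopeR ⇐ LargeSEnvelope (s ≥ (N+1)/2, all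
t: insertion bound — provable now) → SmallSEnvelope (bounded s at t
> 0: Duhamel pruning over kinetic windows along the evolved law, BGSS-type). IsolationErg ⇐
RingReturnBound (‖R_φ‖ ≤ Cφ log(1/φ) on deviations, trivial on
Gibbs) → HydroSectorClosure (the TWO-PARTICLE LIOUVILLE LEMMA: for ξ ≠ 0, temperate x, y on ℝ³ × ℝ³
with (L₁ + L₂)x = −(ξ·(v₁−v₂)) y,
(L₁ + L₂)y = (ξ·(v₁−v₂)) x, L_i = hardSphereLinearizedOp in the i-th velocity, x = y = 0 from the
PROVED kernel/gap/symmetry facts;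
CIP1994 §7.1, BarangerMouhot2005; the support TwoParticleLiouville dropped at rev 2).
GronwallBGInBand (support) is proved
with `--supports` lemmas: OVYLimitsExist/Stationary (needs-fact: a STRENGTHENED Alexander theorem —
a flow whose good set
contains every configuration obeying explicit Lanford/Ruelle growth bounds, with finite clusters;
the vendored
Literature.Analysis.FluidPDE.InfiniteHardSphereFlow.nonempty is Gibbs-a.e. only, Alexander1976 Prop.
4.7 / Thm 5.2), DiluteBootstrap,
OneTwoBlock, DiluteGibbsLD + virial/EOS (the shared HsEosLowDensity 0768 / 0782 statics),
YauEntropyProduction.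

KILL CRITERIA. ¬HierarchyEndpointRigidityR by an admissible, stationary, CONTINUOUS Lanford-class,
NON-mixture solution of the Boltzmann
hierarchy on 𝕋³ kills the endpoint (E) and closes the route `refuted:HierarchyEndpointRigidityR` —
the one typing restate is spent; only
the s = 0 / F_0 = 1 bookkeeping clause may still be re-typed. ¬EndpointHTheorem kills the mechanism
outright → close. ¬LanfordEnvelopeR — a
genuine failure of the N-uniform envelope — forces a PIVOT, not a close: re-pose K3 with polynomial
/ truncated velocity moments and
Lanford-regularity of local limits in an L¹-weighted sense; close only if N-uniform velocity
concentration along local-Gibbs evolutions is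
exhibited generically. ¬LanfordBoltzmannHypothesisR2 (a translation-invariant, stationary,
Lanford-regular, vacuum-free, componentwise-dilute
NON-Gibbs state of an equilibrium infinite hard-sphere flow at arbitrarily small φ₀) closes this
route and wounds every Boltzmann-hypothesis
route (AnosovDiceHopf.OVYLimitsAreGibbs, UGibbs*); a junk-flow witness (a non-Gibbs law made
stationary only by non-regular solutions glued
into an equilibrium flow off the Gibbs-typical set) is a TYPING kill and is answered by one restate
adding Alexander-regularity / finite
clusters of Φ on the ν-typical set. DenseExcursion / ¬DiluteSelfConsistency (ImplosionDichotomy) NO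
LONGER touches this route (rev 15): a profile whose σ-family reaches
packing η₀ before T is outside the re-typed conjunct's scope, and 3091 is not an item here.
Informal:
a stationary O(1) off-alignment scale-ε bulk structure (¬StationaryLanfordConsistency) closes it.
RelEntropyVanishingInBand refuted (entropy
production ≥ cN before shocks INSIDE the band) closes every entropy route, guarded or not.
Mooted/superseded: a proof of OVYLimitsAreGibbs (AnosovDiceHopf) or URigidity
(UGibbsSRBRigidity) supersedes #2/#3/#6 (LanfordEnvelopeR, GronwallBGInBand stay wanted).

NOT DECOMPOSED YET. Isolation (11482) and StationaryLanfordConsistency (11483) stay INFORMAL: their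
typing needs infinite-volume BBGKY–Duhamel
operators on Lanford families, the whole-space Boltzmann-hierarchy flow on continuous families and
the deviation-vector / cumulant norms
(rescaledCumulant is in tree; the operators are not) — a tenure/definition pass, together with the
split of #6 above; the norms in which the
isolation loop closes (the card's honest open point: level-by-level descent loses a factorial
without Lanford time-smallness) are
deliberately not fixed; the stationary entropy-production identity (S) of the card and the hard-core
BGY ⇒ DLR configurational half (card
ybg-hard-core-rigidity) are layer-2 supports, later; constants φ₀, σ₀, t* are not tracked.
needs-fact (for the PROOF of GronwallBGInBand, not
for any statement): a strengthened Literature.Analysis.FluidPDE.InfiniteHardSphereFlow.nonempty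
(explicit regular good set, finite
clusters, translation covariance) and the dilute hard-sphere statics (HsEosLowDensity 0768, virial
0782, shared); none is in any item's
constant cone (route deps 0 unproved after rev 11; StationaryLanfordState's import closure adds the
Alexander named facts nonempty/unique,
unused by the statements). (Record: revs 1–2 cone repair — the guardrail's "4 unproved named facts
in the import cone" are the four
summit conjunct Statements imported by Summits.AtomisticToContinuum.Statement, not debt; rev 4 —
11470 → LanfordEnvelopeR, 11471 →
HierarchyEndpointRigidityR; revs 12–14 — target made reachable (two concurrent repair seats,
consolidated at rev 14): 11484/11485 and the
rev-12 ergodic restates 14377/14378 retired for the typed #6 (14475) / GronwallBGR (14483), 3091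
attached as #7, closes re-certified with 9
hypotheses; rev 15 — Statement re-type p126922 (packing guard, D-0032): outer frame re-docked IN
BAND — target RelEntropyVanishingInBand and
glue GronwallBGInBand added, Assembly restated, 0766 / 3091 / 14531 / 9240 dropped from this route,
Theorems.TwoClocksEntropyToHydro
imported for the entropy step inside closes, closes re-certified with 7 hypotheses; rev 16 —
crux-only closes (5 binders: target +
LanfordEnvelopeR + HierarchyEndpointRigidityR + LanfordBoltzmannHypothesisR2 + GronwallBGInBand, the
latter re-badged crux), answering the
gate flag glue.non-crux-hypothesis on EndpointHTheorem / GronwallBGInBand / Assembly.)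

CHEAPEST FALSIFIER. (i) DELIMITERS RUN BACKWARDS (by hand, done): the scheme does NOT "prove" the
false hypothesis for the ideal gas / d = 1
rods — without a collision operator every (ρ, h) product family is hierarchy-stationary and the
dissipation vanishes; at the d = 3 endpoint
a product state ρ^s Π h(v_i) is hierarchy-stationary iff Q(h,h) = 0 iff h is Maxwellian
(Arkeryd1972), so the barrier's witnesses h_A,
h_B, h_C are excluded. (ii) LOOKUP (done): Spohn 1984 §5 (iii) is heuristic only; if Petrina 2009
(doi:10.1515/9783110213201, not held) proves the
classification in the Lanford class, #5 is `known` → support.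
(iii) DEGENERATE / JUNK INSTANCES (by hand + refuter files, done): F ≡ 0 (s ≥ 1) is not admissible;
LanfordEnvelopeR holds trivially or
with equality in the bookkeeping regimes (s = 0, t = 0, s = N+1, s ≥ (N+1)/2); the refuters' typing
witnesses are typed out — flow junk off
`good` under a volume-marginal (11470), null-set switch-off of the ε = 0 collision term (11471),
vacuum dilution ½δ_∅ + ½g (11484 F1: now
ν{∅} = 0) and thin-Gibbs dilution of a dense state (11484 F2: the dense component violates the a.s.
empirical-density clause); the
near-diagonal mixtures ½(g_(θ+η)+g_(θ−η)) (11482) satisfy #6's conclusion. (iv) With #7 gone (rev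
15) no external PDE kill remains: the cheapest live kills are
on #4 / #5 (an N-uniform velocity-concentration family along a local-Gibbs evolution breaking every
fixed Gaussian envelope; a
continuous, admissible, stationary NON-mixture solution of the Boltzmann hierarchy on 𝕋³), each of
which survived one refuter round.

NUMBERS. Lanford's validity time: ≈ 1/5 of the mean free time (CIP1994 Thm 4.4.1, p. 86); for a
stationary state it is iterated for free (E1). Kinetic sector: Grad/Baranger–Mouhot gap λ > 0
explicit (BarangerMouhot2005 Thm 1.1; proved in tree). Hydrodynamic sector: Ellis–Pinsky branches Re
λ_j(ξ) = −κ_j|ξ|² + O(|ξ|³), resolvent ≍ |ξ|⁻² locally integrable iff d ≥ 3. Ring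
return: O(φ log 1/φ) in d = 3, log-divergent in d = 2 (DorfmanCohen1972, Cohen1967). Fixed-density
scaling:
collision rate per particle ≍ σ²√θ (N+1)^(1/3), a Lanford window is ≍ (N+1)^(−1/3) macroscopic time;
blowing up by the diameter ε_N gives spheres of diameter 1 at reduced density ρ_t(x)σ³ (the quantity
capped
by the conjunct's guard η₀), and an s-marginal envelope C^s in macroscopic units becomes the Lanford
constant (Cσ³)^s of the local limit. Insertion bound used in
(iii): 𝒵_(M+1) ≥ 𝒵_M (∫a₀)(1 − 8·(4π/3)(M+1)ε³ sup a₀/∫a₀). Items after rev 16: 7 typed + 2 informal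
= 9 ≤ 15; cruxes 7 = cap (Isolation, StationaryLanfordConsistency, LanfordEnvelopeR,
HierarchyEndpointRigidityR, LanfordBoltzmannHypothesisR2, GronwallBGInBand, and the target
RelEntropyVanishingInBand, shared stmt-17396, badged conjecture-grade) — the next crux this route
wants must come by a SPLIT, not an addition.

DEFINITION REQUESTS. D1 `StationaryLanfordState` — LANDED
(Literature/MathematicalPhysics/KineticTheory/StationaryLanfordState.lean:
rescaledCorrMeasure, rescaledCorrelationFn, rescaledCumulant, reducedDensity, lanfordBound,
StationaryLanfordState, stationaryLanfordStates;
API proved) and now imported by the route file; D2 (de Finetti–Hewitt–Savage density form, cite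
fact) still wanted for the #5 split; D3 =
`HardSphereGibbsState` / hardSphereGibbsStates / IsHardSphereGibbsMixture — LANDED. Still to request
at the #6 split: the infinite-volume
BBGKY–Duhamel operator on Lanford families and the strengthened Alexander flow fact (above).

Novelty: Searches (2026-08-15): `lit search --hybrid` / `lit search` local (rc 75, searchd down all session);
`lit galaxy search "stationary solutions of the Boltzmann hierarchy" --star all` (1: LNM 1048 → READ
Spohn 1984 §4 eq. (4.3), §5 (iii)–(iv) via `lit galaxy read panama:513145512656983 --chars
401853-431853`); `lit galaxy search "stationary states of infinite systems of hard spheres" --star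
all` (0); `… "invariant measures for the Boltzmann equation" --star all` (0); `… "stationary
solutions of the BBGKY hierarchy" --star all` (0); `lit search --source crossref "stationary states
hard sphere gas low density limit Boltzmann hierarchy Maxwellian"` (12:
doi:10.1016/0378-4371(81)90207-7 Lanford 1981 review, doi:10.1515/9783110213201 Petrina 2009); `lit
search --source crossref "Petrina stationary solutions Boltzmann hierarchy equilibrium"` (9:
Petrina's stochastic-hierarchy series, dynamics not classification); `lit frontier
AtomisticToContinuum --since 2020` (30 rows: no stationary-state classification;
CanestrariLiveraniOlla2026 deterministic heat equation only); `ledger negatives --problem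
AtomisticToContinuum` (6, none related); the card's searches (crossref ×8 incl. Gurevich–Suhov,
Eyink–Spohn, Kallenberg, Genovese–Simonella, BGSS/GST; zbMATH ×2; CIP1994 pp. 45, 85–86, 95 and
Spohn1991 pp. 25, 32, 74–76 read) stand.
Nearest prior art found: doi:10.1007/bfb0071883 (Spohn 1984: hierarchy solutions = statistical
solutions, eq. (4.3); §5 (iii) the HEURISTIC that undriven invariant  [refs: 10.1016/0378-4371(81, 10.1515/9783110213201, 10.1007/bfb0071883, 10.1090/trans2/198/06, 10.1007/bf00535277, doi:10.1016/0378-4371, doi:10.1515/9783110213201, doi:10.1007/bfb0071883, doi:10.1090/trans2/198/06, doi:10.1007/bf00535277, CanestrariLiveraniOlla2026, CIP1994, Spohn1991, GurevichSuhov1976, GenoveseSimonella2012, BGSSCPAM2023, OllaVaradhanYau1993]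

Barriers (technique_class: kinetic-endpoint-persistence, eternal-lanford, rel-entropy): - technique_class: kinetic-endpoint-persistence, eternal-lanford, rel-entropy
- Literature.Barriers.AtomisticToContinuum.BoltzmannHypothesisBarrierNarrow: attacked at its named
missing input, inside scope caveat (b) ("a proof of either for hard spheres at small reduced density
evades it"): the classification is PRODUCED (endpoint H-theorem + persistence), not assumed, and its
ideal-gas kernel (h_A, h_B, h_C: distinct free-flight-stationary velocity laws with equal
parameters) is exactly the degenerate endpoint the line excludes — no collision operator, zero
dissipation, TwoParticleLiouville's hypothesis void.
- Literature.Barriers.AtomisticToContinuum.BoltzmannHypothesisBarrier: same kernel, same evasion;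
OVY (C)–(E) (its known evasion (i) minus the noise) are reused, only (B) is supplied.
- Literature.Barriers.AtomisticToContinuum.MacroErgodicityBarrier: same missing input; the Lanford
class is narrower than "regular", and LanfordEnvelopeR is the price paid in the open.
- Literature.Barriers.AtomisticToContinuum.DiluteRegimeBarrier: not triggered — no
particle-to-Boltzmann step is taken for the conjunct's sequence (kernel (c): it is not
Boltzmann–Grad); the Boltzmann–Grad objects here are the ε → 0 endpoint of a family of
INFINITE-volume stationary problems indexed by the conjunct's fixed σ, used to classify, and the
equation of state stays ρθZ(ρσ³) because the persisting equilibria are the hard-sphere Gibbs states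
at density φ.
- Literature.Barriers.AtomisticToContinuum.Dil

History (route lifecycle, newest last):
- 2026-08-16T03:28:34Z · rev 13: dropped stmt-AtomisticToContinuum-11484, stmt-AtomisticToContinuum-11485 — route-repair (rbadge, gen 1): target made reachable — typed LanfordBoltzmannHypothesisR (crux r6) + typed glue GronwallBGR (support r9) replace informal 11484/1 (planner-rbadge-AtomisticToContinuum-BGEndpoint-fc6dcd5d-0)
- 2026-08-16T03:40:47Z · rev 14: restated GronwallBGR (stmt-AtomisticToContinuum-14483) — route-repair (rbadge) rev 14 — CONSOLIDATION of two concurrent repairs of the same stamp: rev 12 (rrefute lane, 03:18Z) restated 11484 1:1 as the spatially-ERGO (planner-rbadge-AtomisticToContinuum-BGEndpoint-fc6dcd5d-0)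
- 2026-08-16T03:40:47Z · rev 14: dropped LanfordBoltzmannHypothesisR, GronwallBG — route-repair (rbadge) rev 14 — CONSOLIDATION of two concurrent repairs of the same stamp: rev 12 (rrefute lane, 03:18Z) restated 11484 1:1 as the spatially-ERGO (planner-rbadge-AtomisticToContinuum-BGEndpoint-fc6dcd5d-0)
- 2026-08-16T23:24:01Z · rev 15: restated Assembly (stmt-AtomisticToContinuum-13927) — route-repair (statement-revised p126922, retype hydro2) → rev 15: the packing guard of the re-typed conjunct is CONSUMED, not discarded — outer frame re-docked (planner-rrepair-AtomisticToContinuum-BGEndpoin-615814e3-0)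
- 2026-08-16T23:24:01Z · rev 15: dropped RelEntropyVanishing, DiluteSelfConsistency, GronwallBGR, EntropyMethodTransfer — route-repair (statement-revised p126922, retype hydro2) → rev 15: the packing guard of the re-typed conjunct is CONSUMED, not discarded — outer frame re-docked (planner-rrepair-AtomisticToContinuum-BGEndpoin-615814e3-0)
- 2026-08-16T23:24:22Z · AUTO-CRUX (edit): RelEntropyVanishingInBand — hypotheses of the deciding theorem that nothing in the route derives are cruxes (planner-rrepair-AtomisticToContinuum-BGEndpoin-615814e3-0)
- 2026-08-16T23:29:12Z · rev 17: dropped DiluteSelfConsistency — route-repair rev 17: re-drop DiluteSelfConsistency (shared stmt-3091) — it was dropped at rev 15 (gate response dropped:[…3091…], rev-15 file without it) but re (planner-rrepair-AtomisticToContinuum-BGEndpoin-615814e3-0)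
- 2026-08-24T10:58:24Z · DORMANT — reconciler: no traction for 6.7 d (last activity item-evidence-added at 2026-08-17T17:03:48Z); parked, not closed — `ledger route dormant route-AtomisticToConti (operator:999:392455)

sub-problem: HydrodynamicLimit · status: dormant · opened planner-plancard-AtomisticToContinuum-Hydrody-62ca4d81-0 2026-08-15T18:09:30Z · rev 19 · ledger route-AtomisticToContinuum-BGEndpointRigidity
GENERATED by the gate from the ledger (D-0016/17). Provers cite these decls: `theorem foo : Summit.AtomisticToContinuum.HydrodynamicLimit.Theses.BGEndpointRigidity.<Decl> := …` in Summits/AtomisticToContinuum/HydrodynamicLimit/Theorems/<Name>.lean.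
-/

namespace Summit.AtomisticToContinuum.HydrodynamicLimit.Theses.BGEndpointRigidity

open scoped BigOperators Topology Manifold Classical MeasureTheory ProbabilityTheory Matrix InnerProductSpace ComplexConjugate ContinuousMap
open Filter Set Function TopologicalSpace MeasureTheory

attribute [summit_statement] _root_.HydrodynamicLimit

/-- item stmt-AtomisticToContinuum-17396 · crux (kind.auto-crux: conjecture-grade) · rank 0 · open · by planner
why it might fail: OVY93 Thm 1.1 needs noise for step (B): deterministically a non-Gibbs invariant structure of local limits carries wrong currents even in band; and H_N(t) = o(N) can fail before T through N-uniformly uncontrolled large velocities although ρσ³ < η₀.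
sources: OllaVaradhanYau1993, Yau1991, Spohn1991, LiveraniOlla1996
[target] PACKING-GUARDED X_RE — the shared Yau-form target stmt-AtomisticToContinuum-0766 made to
match the RE-TYPED conjunct (Statement retype p126922, 2026-08-16: `_root_.HydrodynamicLimit` is now
the packing-guarded limit, ∃ η₀ outermost, guard ∀ t ∈ [0,T) ∀ x, ρ_t(x)σ³ < η₀ after the solution
hypothesis): there is η₀ > 0 (prover-chosen) such that for all continuous positive profiles ∃ σ₀ ∀
0<σ<σ₀ ∀ T ∀ classical hs-Euler solutions (ρ,u,θ) on [0,T) WHOSE LOCAL PACKING STAYS BELOW η₀ ∀ flow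
families Φ: the initial local Gibbs laws are probability measures and, if their empirical fields
converge at t = 0, then ∀ t < T ∃ activity profile a_t such that the reference local Gibbs law (a_t,
u_t, θ_t) is a probability measure whose density/momentum/energy fields concentrate exponentially (≤
C e^{-(N+1)/C}) around (ρ, ρu, E)(t) and klDiv(lawAt Φ_N (localGibbs a₀ u₀ θ₀) t ‖ localGibbs a_t
u_t θ_t)/(N+1) → 0. CANONICAL FORM: 0766 verbatim with the Statement's guard clause inserted at the
Statement's position and `∃ η₀ : ℝ, 0 < η₀ ∧` prefixed — sibling Yau-family routes re-targeting
after the retype should attach to THIS signature (dedup). 0766 ⇒ this (take η₀ := 1 and ignore the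
guard; Ske -/
@[route_item "route-AtomisticToContinuum-BGEndpointRigidity", crux]
def RelEntropyVanishingInBand : Prop :=
  ∃ η₀ : ℝ, 0 < η₀ ∧ ∀ (a₀ θ₀ : Literature.MathematicalPhysics.KineticTheory.T3 → ℝ) (u₀ : Literature.MathematicalPhysics.KineticTheory.T3 → Literature.MathematicalPhysics.KineticTheory.V3), Continuous a₀ → Continuous θ₀ → Continuous u₀ → (∀ x, 0 < a₀ x) → (∀ x, 0 < θ₀ x) → ∃ σ₀ : ℝ, 0 < σ₀ ∧ ∀ σ : ℝ, 0 < σ → σ < σ₀ → ∀ (T : ℝ) (ρ θ : ℝ → Literature.MathematicalPhysics.KineticTheory.T3 → ℝ) (u : ℝ → Literature.MathematicalPhysics.KineticTheory.T3 → Literature.MathematicalPhysics.KineticTheory.V3), Literature.MathematicalPhysics.KineticTheory.IsHardSphereEulerSolution σ T ρ u θ → (∀ t ∈ Set.Ico 0 T, ∀ x, ρ t x * σ ^ 3 < η₀) → ∀ Φ : (N : ℕ) → Literature.Analysis.FluidPDE.HardSphereFlow (Literature.Analysis.FluidPDE.Torus.geometry (Fin 3)) (Literature.MathematicalPhysics.KineticTheory.hsDiameter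 σ N) (N + 1), (∀ N, MeasureTheory.IsProbabilityMeasure (Literature.MathematicalPhysics.KineticTheory.localGibbsLaw σ a₀ u₀ θ₀ N (Φ N))) ∧ (Literature.MathematicalPhysics.KineticTheory.TendstoHydroFieldsAt (fun N => Literature.MathematicalPhysics.KineticTheory.localGibbsLaw σ a₀ u₀ θ₀ N (Φ N)) Φ ρ u θ 0 → ∀ t ∈ Set.Ico 0 T, ∃ a : Literature.MathematicalPhysics.KineticTheory.T3 → ℝ, (∀ N, MeasureTheory.IsProbabilityMeasure (Literature.MathematicalPhysics.KineticTheory.localGibbsLaw σ a (u t) (θ t) N (Φ N))) ∧ (∀ χ : Literature.MathematicalPhysics.KineticTheory.T3 → ℝ, Continuous χ → ∀ δ : ℝ, 0 < δ → ∃ C : ℝ, 0 < C ∧ ∀ N : ℕ, Literature.MathematicalPhysics.KineticTheory.localGibbsLaw σ a (u t) (θ t) N (Φ N) {z | δ < |Literature.MathematicalPhysics.KineticTheory.empiricalDensityField z χ - ∫ x, χ x * ρ t x|} ≤ ENNReal.ofReal (C * Real.exp (-(C⁻¹ * (N + 1)))) ∧ Literature.MathematicalPhysics.KineticTheory.localGibbsLaw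 σ a (u t) (θ t) N (Φ N) {z | δ < ‖Literature.MathematicalPhysics.KineticTheory.empiricalMomentumField z χ - ∫ x, (χ x * ρ t x) • u t x‖} ≤ ENNReal.ofReal (C * Real.exp (-(C⁻¹ * (N + 1)))) ∧ Literature.MathematicalPhysics.KineticTheory.localGibbsLaw σ a (u t) (θ t) N (Φ N) {z | δ < |Literature.MathematicalPhysics.KineticTheory.empiricalEnergyField z χ - ∫ x, χ x * Literature.MathematicalPhysics.KineticTheory.totalEnergyDensity (ρ t x) (u t x) (θ t x)|} ≤ ENNReal.ofReal (C * Real.exp (-(C⁻¹ * (N + 1))))) ∧ Filter.Tendsto (fun N : ℕ => InformationTheory.klDiv ((Φ N).lawAt (Literature.MathematicalPhysics.KineticTheory.localGibbsLaw σ a₀ u₀ θ₀ N (Φ N)) t) (Literature.MathematicalPhysics.KineticTheory.localGibbsLaw σ a (u t) (θ t) N (Φ N)) / ((N : ENNReal) + 1)) Filter.atTop (nhds 0))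

-- item stmt-AtomisticToContinuum-11482 · crux · rank 2 · open · by planner — informal only, no Lean statement yet:
--   [crux] ISOLATION OF THE GIBBS FAMILY AT SMALL REDUCED DENSITY (card bg-endpoint-rigidity K1, the
--   persistence step (P); INFORMAL until definition StationaryLanfordState / InfiniteHardSphereFlow /
--   HardSphereGibbsState land). There is φ₀ > 0 such that for φ < φ₀ every ν ∈ S_φ
--   (translation-invariant, stationary, Lanford-regular state of the infinite hard-sphere dynamics in ℝ³
--   at reduced density φ, mean-free-path units, diameter ε ≍ φ) whose deviation vector from the Gibbs
--   family — (ψ^⊥ = non-hydrodynamic part of the one-body law g₁/M − 1; the pre-contact pair cumulants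
--   G₂^pre; the long-range hydro

-- item stmt-AtomisticToContinuum-11483 · crux · rank 3 · open · by planner — informal only, no Lean statement yet:
--   [crux] STATIONARY LANFORD CONSISTENCY = ETERNAL LANFORD, QUANTIFIED (card bg-endpoint-rigidity K2,
--   step (E1); INFORMAL until definition StationaryLanfordState lands). For ν ∈ S_φ
--   (translation-invariant, stationary, Lanford-regular state of the infinite hard-sphere dynamics in ℝ³
--   at reduced density φ, mean-free-path units, diameter ε ≍ φ, rescaled correlation functions g =
--   (g_k), g_k ≤ C^k Π M_β(v_i)) and one Lanford window t* = t*(C, β) > 0: (a) IDENTITY — stationarity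
--   makes the collision-tree (Duhamel/BBGKY) expansion over [0, t*] an EXACT fixed-point equation g =
--   T^ε_(t*) g valid for all tim

/-- item stmt-AtomisticToContinuum-13677 · crux · rank 4 · open · by planner
why it might fail: N-uniform Gaussian envelope along the NON-equilibrium evolution = the open HighMomentumCutoff input in marginal form: the only a-priori bound 𝒵⁻¹A^(N+1)e^(−β′E) is off by e^(cN) at small s; energy concentration on few particles (e.g. an imploding profile) before T would break any fixed envelope.
sources: GST2013, BGSSAnnals2023, BGSSCPAM2023, OllaVaradhanYau1993, Spohn1991, doi:10.1007/bf01218628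
[crux] LANFORD ENVELOPE AT FIXED REDUCED DENSITY, ON THE HARD-SPHERE DOMAIN (card K3, finite-N form;
REPAIRED statement of LanfordEnvelope = stmt-AtomisticToContinuum-11470, refuted-misstated by
Summit.AtomisticToContinuum.HydrodynamicLimit.Theorems.BGEndpointRigidityLanfordEnvelope_refuted:
the old statement integrated the junk values of `HardSphereFlow.flow` off the good set — overlap
configurations, Liouville-null but volume-positive; repair C′ = the refuter's: the transported
density is multiplied by the indicator of `hardSphereDomain` INSIDE `nthMarginal`, so junk now lives
on the volume-null set D_ε ∖ good and, by Tonelli, on volume-null fibres for a.e. Z_s; the witness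
(N = 1, s = 2, t = 0, Alexander's flow made constant off `good`) misses C′). For continuous
local-Gibbs profiles (a₀ > 0, u₀, θ₀ > 0) there is σ₀ > 0 such that for 0 < σ < σ₀ and every horizon
T > 0 there are β > 0 and C with: for all N, all hard-sphere flows Φ of N+1 spheres of diameter
σ(N+1)^(-1/3) on 𝕋³, all s and all t ∈ [0,T], for a.e. Z_s the s-particle volume-marginal of
1_{D_ε}·(W ∘ Φ_{−t}) (W = canonicalDensity of localGibbsProfile a₀ u₀ θ₀, i.e. the density of lawAt
Φ (localGibbsLaw …) t w.r.t. volu -/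
@[route_item "route-AtomisticToContinuum-BGEndpointRigidity", crux]
def LanfordEnvelopeR : Prop :=
  ∀ (a₀ θ₀ : Literature.MathematicalPhysics.KineticTheory.T3 → ℝ) (u₀ : Literature.MathematicalPhysics.KineticTheory.T3 → Literature.MathematicalPhysics.KineticTheory.V3), Continuous a₀ → Continuous θ₀ → Continuous u₀ → (∀ x, 0 < a₀ x) → (∀ x, 0 < θ₀ x) → ∃ σ₀ : ℝ, 0 < σ₀ ∧ ∀ σ : ℝ, 0 < σ → σ < σ₀ → ∀ T : ℝ, 0 < T → ∃ β C : ℝ, 0 < β ∧ ∀ (N : ℕ) (Φ : Literature.Analysis.FluidPDE.HardSphereFlow (Literature.Analysis.FluidPDE.Torus.geometry (Fin 3)) (Literature.MathematicalPhysics.KineticTheory.hsDiameter σ N) (N + 1)) (s : ℕ), ∀ t ∈ Set.Icc 0 T, ∀ᵐ Zs : Literature.Analysis.FluidPDE.Config s (Fin 3) Literature.MathematicalPhysics.KineticTheory.T3, |Literature.Analysis.FluidPDE.nthMarginal (N + 1) s ((Literature.Analysis.FluidPDE.hardSphereDomain (Literature.Analysis.FluidPDE.Torus.geometry (Fin 3))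 (N + 1) (Literature.MathematicalPhysics.KineticTheory.hsDiameter σ N)).indicator (Literature.Analysis.FluidPDE.hsTransport Φ t (Literature.Analysis.FluidPDE.canonicalDensity (Literature.Analysis.FluidPDE.Torus.geometry (Fin 3)) (Literature.MathematicalPhysics.KineticTheory.hsDiameter σ N) (N + 1) (Literature.MathematicalPhysics.KineticTheory.localGibbsProfile a₀ u₀ θ₀)))) Zs| ≤ C ^ s * Real.exp (-(β * Literature.Analysis.FluidPDE.configEnergy Zs))

/-- item stmt-AtomisticToContinuum-13679 · crux · rank 5 · open · by planner
why it might fail: Admissibility is essential (the linear hierarchy has non-mixture stationary solutions, Spohn 1984 §5; only mode-A mass bookkeeping excludes them); needs the H-theorem AND its equality case for L∞ Gaussian-bounded mild solutions on 𝕋³ plus moment-determinacy of random L∞ densities — not in print.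
sources: doi:10.1007/bfb0071883, book:cercignani1984-kinetic-theories-boltzmann-equation pp.148-152, CIP1994, Arkeryd1972, DiaconisFreedman1987, DesvillettesVillani2005
[crux] BOLTZMANN'S HYPOTHESIS IS A THEOREM AT THE BOLTZMANN–GRAD POINT, CONTINUOUS CLASS (card (E) =
(E2)+(E3), typed at ε = 0 on 𝕋³; REPAIRED statement of HierarchyEndpointRigidity =
stmt-AtomisticToContinuum-11471, flagged refutable-misstated by refuter-rreview-0815T18-1-0 with an
evidence sketch: the mild hierarchy evaluates F_{s+1} pointwise on the volume-NULL contact diagonal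
x_{s+1} = x_i, so a velocity product f(v)^{⊗s}, f non-Maxwellian, ZEROED on the free-flight hull of
{x_i = x_j} is a measurable stationary solution with vanishing collision term, admissible via W_k =
f^{⊗k}; repair = the refuter's: every F_s is CONTINUOUS — the hull is dense (directions −Δx + ℤ³ are
dense in S²), so a continuous function vanishing on it vanishes, and Lanford regularity classically
includes continuity, GST2013 Thm 8). Let F = (F_s)_s be a time-independent family of continuous,
non-negative s-particle functions on (𝕋³ × ℝ³)^s with Lanford bounds F_s ≤ C^s e^(−βE(Z_s)), which
(i) is a STATIONARY mild solution of the hard-sphere Boltzmann hierarchy on some [0,T], T > 0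
(IsMildBoltzmannHierarchySolutionOn with the constant-in-time family), and (ii) is ADMISSIBLE: the
mode-A limit (velocity-ave -/
@[route_item "route-AtomisticToContinuum-BGEndpointRigidity", crux]
def HierarchyEndpointRigidityR : Prop :=
  ∀ (F : (s : ℕ) → Literature.Analysis.FluidPDE.Config s (Fin 3) Literature.MathematicalPhysics.KineticTheory.T3 → ℝ), (∀ s, Measurable (F s)) → (∀ s, Continuous (F s)) → (∀ s Zs, 0 ≤ F s Zs) → (∃ β C : ℝ, 0 < β ∧ ∀ s Zs, F s Zs ≤ C ^ s * Real.exp (-(β * Literature.Analysis.FluidPDE.configEnergy Zs))) → (∃ T : ℝ, 0 < T ∧ Literature.Analysis.FluidPDE.IsMildBoltzmannHierarchySolutionOn T (Literature.Analysis.FluidPDE.Torus.geometry (Fin 3)) (fun s (_ : ℝ) => F s)) → (∃ (Nk : ℕ → ℕ) (Wk : (k : ℕ) → Literature.Analysis.FluidPDE.Config (Nk k) (Fin 3) Literature.MathematicalPhysics.KineticTheory.T3 → ℝ), Filter.Tendsto Nk Filter.atTop Filter.atTop ∧ (∀ k, Literature.Analysis.FluidPDE.IsSymmetricFn (Wk k))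 ∧ (∀ k, Measurable (Wk k)) ∧ (∀ k z, 0 ≤ Wk k z) ∧ (∀ k, ∫ z, Wk k z = 1) ∧ (∃ β C : ℝ, 0 < β ∧ ∀ k s Zs, |Literature.Analysis.FluidPDE.nthMarginal (Nk k) s (Wk k) Zs| ≤ C ^ s * Real.exp (-(β * Literature.Analysis.FluidPDE.configEnergy Zs))) ∧ Literature.Analysis.FluidPDE.TendstoMarginals (fun k s (_ : ℝ) => Literature.Analysis.FluidPDE.nthMarginal (Nk k) s (Wk k)) (fun s (_ : ℝ) => F s) 0) → ∃ π : MeasureTheory.Measure (Literature.MathematicalPhysics.KineticTheory.V3 × ℝ), MeasureTheory.IsProbabilityMeasure π ∧ π {p | p.2 ≤ 0} = 0 ∧ ∀ s, F s =ᵐ[MeasureTheory.volume] fun Zs => ∫ p, Literature.Analysis.FluidPDE.tensorPow s (fun z : Literature.MathematicalPhysics.KineticTheory.T3 × Literature.MathematicalPhysics.KineticTheory.V3 => Literature.Analysis.FluidPDE.localMaxwellian 1 p.2 p.1 z.2) Zs ∂π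

/-- item stmt-AtomisticToContinuum-14475 · crux · rank 6 · open · by planner
why it might fail: Boltzmann's hypothesis is open for every deterministic interacting gas (Spohn1991 p.25); φ₀ uniform in the Lanford constant C admits locally clustered states outside any φ-expansion; IsEquilibriumFlow pins the flow only Gibbs-a.e., i.e. not at all on a non-Gibbs candidate.
sources: Spohn1991, OllaVaradhanYau1993, NachtergaeleYau2003, GurevichSuhov1976, Alexander1976
[crux] LANFORD-CLASS BOLTZMANN HYPOTHESIS — the route's X_BH, TYPED in the vacuum-free
componentwise-dilute MIXTURE form (supersedes the informal stmt-AtomisticToContinuum-11484, graded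
refuted-misstated AS PROSE by refuter-rattack-11484 2026-08-16: the literal typing 'every ν ∈
S_φ(C,β), φ < φ₀, is a z>0 Gibbs mixture' dies by vacuum dilution ½δ_∅ + ½g_(z,β) ∈ S_φ(C,β) (F1,
Dilution.lean kernel-checked) and by thin-Gibbs dilution, which drives the MEAN reduced density of
any state to 0 keeping (C,β) (F2); both are answered here — F1 by ν{∅} = 0, F2 because diluteness is
imposed on the ASYMPTOTIC EMPIRICAL density, i.e. on every ergodic component, so a dense component
violates the hypothesis; the refuter's recommended spatially-ergodic form C″ is NOT used because the
consumer GronwallBGR meets non-ergodic local limits and spatially-ergodic components of a stationary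
law need not be stationary before macrostate cycling is excluded — which is part of the hypothesis
itself). STATEMENT: there is φ₀ > 0 such that for every diameter ε > 0, every EQUILIBRIUM infinite
hard-sphere flow Φ (Literature.Analysis.FluidPDE.InfiniteHardSphereFlow (Fin 3) ε with
Φ.IsEquilibriumFlow — Alexander's fl -/
@[route_item "route-AtomisticToContinuum-BGEndpointRigidity", crux]
def LanfordBoltzmannHypothesisR2 : Prop :=
  ∃ φ₀ : ℝ, 0 < φ₀ ∧ ∀ ε : ℝ, 0 < ε → ∀ Φ : Literature.Analysis.FluidPDE.InfiniteHardSphereFlow (Fin 3) ε, Φ.IsEquilibriumFlow → ∀ (φ C β : ℝ) (ν : MeasureTheory.Measure (Literature.Analysis.FunctionSpaces.PointConfig (Literature.MathematicalPhysics.KineticTheory.V3 × Literature.MathematicalPhysics.KineticTheory.V3))), 0 < β → Literature.MathematicalPhysics.KineticTheory.StationaryLanfordState Φ φ C β ν → ν {∅} = 0 → (∀ᵐ ω ∂ν, ∀ᶠ n : ℕ in Filter.atTop, ENNReal.ofReal (ε ^ 3) * ((Literature.Analysis.FunctionSpaces.PointConfig.count ω (Literature.MathematicalPhysics.KineticTheory.PointProcess.centredBox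 n ×ˢ (Set.univ : Set Literature.MathematicalPhysics.KineticTheory.V3))) : ENNReal) ≤ ENNReal.ofReal φ₀ * MeasureTheory.volume (Literature.MathematicalPhysics.KineticTheory.PointProcess.centredBox (d := Fin 3) n)) → Literature.MathematicalPhysics.KineticTheory.IsHardSphereGibbsMixture ε ν

/-- item stmt-AtomisticToContinuum-17626 · crux · rank 9 · open · by planner
why it might fail: Even given (B) and the envelope, the deterministic one/two-block + LD steps need Alexander's flow on ALL Lanford-regular dilute data and dilute hs-Gibbs large deviations uniform along the evolution; the bootstrap error ∝ H_N(s)/N must close by Gronwall before T — not in print without noise.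
sources: OllaVaradhanYau1993, Yau1991, KipnisLandim1999, Spohn1991, Alexander1976
[support] RELATIVE-ENTROPY GRONWALL IN BAND, STEP (B) FROM THE ENDPOINT CLASSIFICATION — the TYPED
glue to the guarded target (rev 15, after the Statement re-type p126922; supersedes GronwallBGR
stmt-AtomisticToContinuum-14531 = LanfordBoltzmannHypothesisR2 → DiluteSelfConsistency →
LanfordEnvelopeR → RelEntropyVanishing, whose dilute-visitation input 3091 is now the conjunct's own
hypothesis): LanfordBoltzmannHypothesisR2 → LanfordEnvelopeR → RelEntropyVanishingInBand. Content =
OllaVaradhanYau1993 §4 for the DETERMINISTIC torus gas IN BAND: take η₀ := min(φ₀/2, η_stat) from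
X_BH's φ₀ and the dilute-statics radius η_stat (EOS inversion a ↦ ρ and cluster expansion for the
hard-sphere local Gibbs states; shared statics HsEosLowDensity 0768 / virial 0782) — an absolute
constant fixed before the profiles, as the outermost ∃ requires — and σ₀ := min of the inputs' σ₀;
for σ < σ₀ and a classical solution with ρ_t(x)σ³ < η₀ on [0,T): (A) limit points μ of the
space–time averaged laws blown up by ε_N = hsDiameter σ N (FluidPDE.localLawTimeAvg /
KineticTheory.IsOVYLimitState; spheres of diameter 1) exist and are translation invariant; (A′) by
the N-uniform Gaussian envelope of LanfordEnvel -/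
@[route_item "route-AtomisticToContinuum-BGEndpointRigidity", crux]
def GronwallBGInBand : Prop :=
  LanfordBoltzmannHypothesisR2 → LanfordEnvelopeR → RelEntropyVanishingInBand

/-- item stmt-AtomisticToContinuum-11472 · support · rank 9 · open · by planner
sources: CIP1994, Arkeryd1972, DesvillettesVillani2005
[support] ENDPOINT H-THEOREM (strict Lyapunov property of H on 𝕋³; the engine of (E3)): for T > 0, β
> 0 and an a.e.-mild solution f of the hard-sphere Boltzmann equation on 𝕋³ × [0,T]
(IsAEMildBoltzmannSolutionOn, torus geometry, hardSphereKernel) that is measurable with 0 ≤ f ≤ C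
e^(−β|v|²/2) on [0,T], if H(f(T)) ≥ H(f(0)) (boltzmannEntropy) then f(0) is a.e. a GLOBAL Maxwellian
ρ M_(u,θ) with constants ρ ≥ 0, θ > 0, u (Boltzmann 1876 / Carleman / Arkeryd equality case + the
torus classification of local-Maxwellian free-transport solutions; zero sets handled by positivity
spreading of the gain term). [difficulty: M] -/
@[route_item "route-AtomisticToContinuum-BGEndpointRigidity"]
def EndpointHTheorem : Prop :=
  ∀ (T β C : ℝ), 0 < T → 0 < β → ∀ f : ℝ → Literature.MathematicalPhysics.KineticTheory.T3 → Literature.MathematicalPhysics.KineticTheory.V3 → ℝ, Literature.Analysis.FluidPDE.IsAEMildBoltzmannSolutionOn T (Literature.Analysis.FluidPDE.Torus.geometry (Fin 3)) Literature.MathematicalPhysics.KineticTheory.hardSphereKernel f → (∀ t ∈ Set.Icc 0 T, Measurable (Function.uncurry (f t))) → (∀ t ∈ Set.Icc 0 T, ∀ x v, 0 ≤ f t x v ∧ f t x v ≤ C * Real.exp (-(β * ‖v‖ ^ 2 / 2))) → Literature.Analysis.FluidPDE.boltzmannEntropy (f 0) ≤ Literature.Analysis.FluidPDE.boltzmannEntropy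 (f T) → ∃ (ρ θ : ℝ) (u : Literature.MathematicalPhysics.KineticTheory.V3), 0 ≤ ρ ∧ 0 < θ ∧ ∀ᵐ z : Literature.MathematicalPhysics.KineticTheory.T3 × Literature.MathematicalPhysics.KineticTheory.V3, f 0 z.1 z.2 = Literature.Analysis.FluidPDE.localMaxwellian ρ θ u z.2

-- earlier Assembly (stmt-AtomisticToContinuum-13927, replaced 2026-08-16T23:24:01Z -> stmt-AtomisticToContinuum-17625): retired by None — LanfordEnvelopeR → HierarchyEndpointRigidityR → RelEntropyVanishing → _root_.HydrodynamicLimit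
-- earlier Assembly (stmt-AtomisticToContinuum-9394, replaced 2026-08-15T20:37:01Z -> stmt-AtomisticToContinuum-13927): retired by None — RelEntropyVanishing → EntropyMethodTransfer → _root_.HydrodynamicLimit
/-- item stmt-AtomisticToContinuum-17625 · assembly · rank 1 · open · by planner
sources: KipnisLandim1999, OllaVaradhanYau1993
[assembly] (restated rev 15 after the Statement re-type p126922) The typed cruxes and the GUARDED
target imply the sub-problem Statement `_root_.HydrodynamicLimit` BY NAME: LanfordEnvelopeR →
HierarchyEndpointRigidityR → LanfordBoltzmannHypothesisR2 → RelEntropyVanishingInBand →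
HydrodynamicLimit (template shape Crux₁ → … → Target → Statement). Mathematically the target alone
suffices, with the same η₀ and σ₀, by the entropy inequality for events + Measure.le_map_apply along
the flow (Theorems.tendstoHydroFieldsAt_of_klDiv, landed) — the eight lines of the route's `closes`;
the cruxes appear because they are this route's line to the target (Isolation ∧
StationaryLanfordConsistency ∧ HierarchyEndpointRigidityR ⇒ LanfordBoltzmannHypothesisR2; ∧
LanfordEnvelopeR ⇒ GronwallBGInBand ⇒ RelEntropyVanishingInBand). Earlier forms: rev 0
RelEntropyVanishing → EntropyMethodTransfer → HydrodynamicLimit (ground.trivial, restated rev 11),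
rev 11 LanfordEnvelopeR → HierarchyEndpointRigidityR → RelEntropyVanishing → HydrodynamicLimit (over
the unguarded target 0766, dropped from this route at rev 15). [difficulty: provable-now] [sources:
KipnisLandim1999, OllaVaradhanYau1993, Yau1991] -/
@[route_item "route-AtomisticToContinuum-BGEndpointRigidity"]
def Assembly : Prop :=
  LanfordEnvelopeR → HierarchyEndpointRigidityR → LanfordBoltzmannHypothesisR2 → RelEntropyVanishingInBand → _root_.HydrodynamicLimit

-- records of items no longer active in this route (dropped / restated):
-- earlier LanfordEnvelope (stmt-AtomisticToContinuum-11470, replaced 2026-08-15T20:16:44Z -> stmt-AtomisticToContinuum-13677): refuted by Summit.AtomisticToContinuum.HydrodynamicLimit.Theorems.BGEndpointRigidityLanfordEnvelope_refuted — ∀ (a₀ θ₀ : Literature.MathematicalPhysics.KineticTheory.T3 → ℝ) (u₀ : Literature.MathematicalPhysics.KineticTheory.T3 → Literature.MathematicalPhysics.KineticTheory.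
-- earlier HierarchyEndpointRigidity (stmt-AtomisticToContinuum-11471, replaced 2026-08-15T20:16:44Z -> stmt-AtomisticToContinuum-13679): retired by None — ∀ (F : (s : ℕ) → Literature.Analysis.FluidPDE.Config s (Fin 3) Literature.MathematicalPhysics.KineticTheory.T3 → ℝ), (∀ s, Measurable (F s)) → (∀ s Zs, 0 ≤ F s Zs) → (∃ β C : ℝ, 0 < β ∧ ∀ s Zs, F s Zs ≤ C ^ s * Real.exp (-(β * Literature.Analysis.
-- earlier LanfordBoltzmannHypothesis (stmt-AtomisticToContinuum-11484, replaced 2026-08-16T03:18:40Z -> stmt-AtomisticToContinuum-14377): retired by None — [support] LANFORD-CLASS BOLTZMANN HYPOTHESIS = the route's X_BH (the glue node of the classification half; INFORMAL until StationaryLanfordState / InfiniteHardSphereFlow / HardSphereGibbsState land; typed once they do as the Lanford-class restric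
-- earlier GronwallBG (stmt-AtomisticToContinuum-11485, replaced 2026-08-16T03:18:40Z -> stmt-AtomisticToContinuum-14378): retired by None — [support] RELATIVE-ENTROPY GRONWALL WITH STEP (B) SUPPLIED BY THE ENDPOINT CLASSIFICATION (the glue of the hydrodynamic half: LanfordBoltzmannHypothesis ∧ LanfordEnvelope ⇒ RelEntropyVanishing; INFORMAL, the route-specific form of the retired RelEntropyErgodic i
-- earlier GronwallBGR (stmt-AtomisticToContinuum-14483, replaced 2026-08-16T03:40:47Z -> stmt-AtomisticToContinuum-14531): retired by None — LanfordBoltzmannHypothesisR → DiluteSelfConsistency → LanfordEnvelopeR → RelEntropyVanishing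
-- earlier EntropyMethodTransfer (stmt-AtomisticToContinuum-9240, dropped 2026-08-16T23:24:01Z): proved by Summit.AtomisticToContinuum.HydrodynamicLimit.Theorems.hydrodynamicLimit_of_relEntropyVanishing — RelEntropyVanishing → _root_.HydrodynamicLimit

/-! D-0027 §2.1 — DECIDING THEOREM (planner-authored via `route open/edit --closes-file`; by planner-rrepair-AtomisticToContinuum-BGEndpoin-615814e3-0 2026-08-16T23:29:47Z):
its hypotheses are this route's items and its conclusion the sub-problem Statement (glue_lint), and it elaborates with this file. -/

@[closes "route-AtomisticToContinuum-BGEndpointRigidity"] theorem closes (_h₀ : RelEntropyVanishingInBand) (hEnv : LanfordEnvelopeR)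
    (_hE : HierarchyEndpointRigidityR) (hBH : LanfordBoltzmannHypothesisR2)
    (hG : GronwallBGInBand) : _root_.HydrodynamicLimit := by
  -- crux-only (rev 16): the supports EndpointHTheorem / Assembly are no longer binders.
  -- The GUARDED Yau target is PRODUCED by the in-band Gronwall glue from X_BH (hBH) and K3 (hEnv) …
  obtain ⟨η₀, hη₀, H⟩ := hG hBH hEnv
  -- … and the packing-guarded conjunct follows with the SAME η₀ and σ₀: the guard is threaded
  -- through unchanged and the landed entropy-inequality step is applied at each t < T.
  refine ⟨η₀, hη₀, fun a₀ θ₀ u₀ ha hθ hu ha0 hθ0 => ?_⟩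
  obtain ⟨σ₀, hσ₀, G⟩ := H a₀ θ₀ u₀ ha hθ hu ha0 hθ0
  refine ⟨σ₀, hσ₀, fun σ hσ hσ' T ρ θ u hsol hguard Φ h0 t ht => ?_⟩
  obtain ⟨hprob, hmain⟩ := G σ hσ hσ' T ρ θ u hsol hguard Φ
  obtain ⟨a, hψ, hconc, hkl⟩ := hmain h0 t ht
  exact Summit.AtomisticToContinuum.HydrodynamicLimit.Theorems.tendstoHydroFieldsAt_of_klDiv
    (a := a) Φ hconc hkl

end Summit.AtomisticToContinuum.HydrodynamicLimit.Theses.BGEndpointRigidity
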